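/-
Copyright (c) 2026 the pub-hodgecm-mathlib formalisation cell (harness21).  Prover seat hodgecm-mathlib-LH7-p05 (g0), req620 Track A «(D-RAM) FOUR-FRAME» squad, helper lane on
h413 = stmt-HodgeConjecture-24833 (count-neutral).  β-BOARD row R8-EQ-b «H(ρ) ABOVE THE LOCUS ON THE EQUILATERAL KEY» (β chair F0P3a-p01 (g37) LEDGER #17), FILE EQ-2b.  2026-09-04.
-/
import Summits.HodgeConjecture.HodgeConjecture.Theorems.F0P3cDyRamLabelledOddGluedRepClassSumHead    -- ★ p861678 (this seat): LEMMA B `sum_productTransversal_classSign_eq`; brings FILE 1 §0 transversals, ★ PT, ★ deep-ratio subgroup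
import Summits.HodgeConjecture.HodgeConjecture.Theorems.F0P3cDyRamLabelledOddCoreHangingClassSum      -- ★ FILE 2b (LH7-p08 (g0)): LEMMA A `two_mul_card_mul_labelledOddCount_coreHanging_rep_eq`
import Summits.HodgeConjecture.HodgeConjecture.Theorems.F0P3cDyRamLabelledOddCoreHangingWindowSigns    -- EQ-2a (this seat): `isVertexLattice_zero_latt_coreHanging_rep`, `coreHanging_rep_polarisation_fixed_ne_zero`
import Summits.HodgeConjecture.HodgeConjecture.Theorems.F0P3cDyRamDiagonalCoreHangingCount            -- ★ B7 (iv) (C) (LH4-p07): `isNormalisedLattice_latt_coreHanging`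
import HarnessLib

/-!
# Crux `H413`, line LH4 «(D-RAM) FOUR-FRAME» — (β) table, β-BOARD row R8-EQ-b (THE EQUILATERAL KEY, `H(ρ)` ABOVE THE LOCUS), FILE EQ-2b:
# THE PER-REPRESENTATIVE HEAD ON `latt V_H(1,1,g)` IN ★ PT-3's PRODUCT LETTERS — `lOC_i ∕ [𝒰 : N] = ω(D_i)·w ∕ (2·#Aβ·#Aγ) · Σ_{aβ, aγ} ω(class_i)·ω(g g_α + aγ T⁻¹ g_β)`

Cell `hodgecm-mathlib` (D-0151), FLOOR 0, crux item H413 = `stmt-HodgeConjecture-24833`, route `HCCMUnconditional`; squad F0∕P3c∕LH4 (β-table fan; β chair F0P3a-p01 (g37), H-line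
junction LH4-p05 (g9)).  THEOREMS ONLY (no `def`, no instance, no notation, no `sorry`, default heartbeats); ★-only imports; lane `--supports stmt-HodgeConjecture-24833 --as helper`
(count-neutral); pays NO row, states NO law.  Consumer: this seat's FILE EQ-2c (the window assembly for `H(ρ)` on the equilateral key) — and, letters permitting, LH7-p08 (g0)'s
R8-EQ-a locus stratum.

THE MATHEMATICS — the `t′ = 0` twin of ★ p861678 `labelledOddCount_div_relIndex_glued_rep_eq`, proof VERBATIM with the core-hanging bricks substituted: LEMMA A is LH7-p08's ★ FILE 2b
`two_mul_card_mul_labelledOddCount_coreHanging_rep_eq` (over a transversal `R` of `S_F ∕ N′`, FILE 1 §0, the ★ PT-3 product transversal `R₀ = A₀·{(1, ψ, ψ aβ)}` at `t = 0` and the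
★ PT-1 deep-ratio subgroup `N(D(ρ,0))`), the polarisation `D(g) = π₀^{−ρ}(g, 1, −(1+g)⁻¹)` is EQ-2a `isVertexLattice_zero_latt_coreHanging_rep`, the representative is normalised by ★
`isNormalisedLattice_latt_coreHanging`; LEMMA B (`A₀ = {1, c}` kills the `κ`-part) and the index identity `#(R₀∩N′)·[𝒰 : N′] = #R₀·[𝒰 : S_F]`, `#R₀ = 2·#Aβ·#Aγ`, are unchanged.
Letters: `g` a `σ`-fixed UNIT with `|1 + g| = 1`; `Aβ` a norm-class system of `U_F^{[ρ]}` to depth `2ρ`, `Aγ` of `U_F^{[2ρ]}` to depth `2ρ`; tokens `g_α, g_β` in ★ FILE 2b's letters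
(weight `π₀^{−ρ}`, precision `ϖ^{m*}`); `hL` the non-vanishing of the linear forms (EQ-2a `classSign_mul_labelSign_eq_unit` on the window cut).
HONEST LABEL: count-neutral; R8-EQ ∕ hH ∕ hRest ∕ (β-BAL) ∕ (β) ∕ T₊ OPEN; `HC_CM` is proved only modulo the 7 printed citations (2 remaining named inputs: hLiu418 =
`stmt-HodgeConjecture-24832`, h413 = `stmt-HodgeConjecture-24833`) until rung 0 closes.
References: [Kottwitz1986BaseChangeUnits] §1 pp. 240–241 · [LanglandsShelstad1987] §3 · [Rogawski1990] §4.9 Prop. 4.9.1 (a)(b) p. 55 · [Serre1979] Ch. V §3 Cor. 3.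
-/

set_option autoImplicit false

noncomputable section

namespace Summit.HodgeConjecture.HodgeConjecture.Cruxes.H413.F0P3cDyRamLabelledOddCoreHangingRepClassSum

open Matrix WithZero
open Literature.NumberTheory.Automorphic Literature.NumberTheory.Automorphic.HermitianLattice Literature.NumberTheory.Automorphic.UnitaryGroup
open Literature.NumberTheory.Automorphic.UnitaryLatticeTree Literature.NumberTheory.Automorphic.UnitaryThreeFourFrame
open Literature.NumberTheory.LocalFields Literature.NumberTheory.LocalFields.WildQuadraticDatum
open Summit.HodgeConjecture.HodgeConjecture.Cruxes.H413.F0P3cDyRamFourFramePieces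
open Summit.HodgeConjecture.HodgeConjecture.Cruxes.H413.F0P3cDyRamFourFrameCensusDefs
open Summit.HodgeConjecture.HodgeConjecture.Cruxes.H413.F0P3cDyRamDiagonalTorusDefs
open Summit.HodgeConjecture.HodgeConjecture.Cruxes.H413.F0P3cDyRamLabelledOddCountDefs
open Summit.HodgeConjecture.HodgeConjecture.Cruxes.H413.F0P3cDyRamLabelledOddOneSlotRead (map_unitNormMap_unitStabilizer_le)
open Summit.HodgeConjecture.HodgeConjecture.Cruxes.H413.F0P3cDyRamDiagonalLabelledOddOrbitCount (relIndex_map_unitNormMap_unitStabilizer_ne_zero)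
open Summit.HodgeConjecture.HodgeConjecture.Cruxes.H413.F0P3cDyRamDiagonalOrbitFibreTransport (fibre_isCoset_zero)
open Summit.HodgeConjecture.HodgeConjecture.Cruxes.H413.F0P3cDyRamGluedDeepRatioSubgroup (exists_deepRatioSubgroup map_deepRatioSubgroup_le_map_unitStabilizer_glued_rep)
open Summit.HodgeConjecture.HodgeConjecture.Cruxes.H413.F0P3cDyRamGluedProductTransversal (productTransversal_glued_rep exists_productTransversal)
open Summit.HodgeConjecture.HodgeConjecture.Cruxes.H413.F0P3cDyRamDiagonalOrbitFibreCountHeads (finite_unitTorus_orbit_of_mem_normalisedStableLattices)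
open Summit.HodgeConjecture.HodgeConjecture.Cruxes.H413.F0P3cDyRamStableCountTypeZero (v_diag_eq_one diag_regular)
open Summit.HodgeConjecture.HodgeConjecture.Cruxes.H413.F0P3cDyRamDiagonalOrbitAveraging (relIndex_fixedUnitStabilizer_ne_zero_of_finite)
open Summit.HodgeConjecture.HodgeConjecture.Cruxes.H413.F0P3cDyRamLabelledOddGluedRepClassSum (card_eq_relIndex_of_transversal exists_transversal_of_relIndex_ne_zero)
open Summit.HodgeConjecture.HodgeConjecture.Cruxes.H413.F0P3cDyRamLabelledOddGluedRepClassSumHead (sum_productTransversal_classSign_eq)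
open Summit.HodgeConjecture.HodgeConjecture.Cruxes.H413.F0P3cDyRamLabelledOddCoreHangingClassSum (two_mul_card_mul_labelledOddCount_coreHanging_rep_eq)
open Summit.HodgeConjecture.HodgeConjecture.Cruxes.H413.F0P3cDyRamLabelledOddCoreHangingWindowSigns (isVertexLattice_zero_latt_coreHanging_rep coreHanging_rep_polarisation_fixed_ne_zero)
open Summit.HodgeConjecture.HodgeConjecture.Cruxes.H413.F0P3cDyRamDiagonalCoreHangingCount (isNormalisedLattice_latt_coreHanging)
open scoped Valued WithZero Matrix MatrixGroups

variable {K : Type} [Field K] [Valued K ℤᵐ⁰] [CompleteSpace K] [Fintype 𝓀[K]] {σ : K →+* K} {ϖ : K} {d t : ℕ} {α β : K} {N₀ n₁ n₂ n₃ : ℕ}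

open Classical in
/-- **HEAD — THE β-TABLE SUMMAND OF THE CORE-HANGING REPRESENTATIVE `latt V_H(1,1,g)` (`g` a fixed admissible UNIT) ON THE CLEAN SHELL, IN ★ PT-3's PRODUCT LETTERS
(`t′ = 0` twin of ★ p861678, LEMMA A := LH7-p08 (g0)'s ★ FILE 2b `two_mul_card_mul_labelledOddCount_coreHanging_rep_eq`)**:
`lOC_i(latt V) ∕ [𝒰 : N(S̃(latt V))] = ω(D(g)_i) · stabiliserWeight(latt V) ∕ (2·#Aβ·#Aγ) · Σ_{aβ, aγ} ω(Y_i)·ω(g·g_α + ψ·g_β)` — LEMMA A + LEMMA B + the index identity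
`#(R₀∩N′)·[𝒰 : N′] = #R₀·[𝒰 : S_F]` (§0, `Subgroup.relIndex_mul_relIndex`), `#R₀ = 2·#Aβ·#Aγ` (★ `exists_productTransversal`).  `hL` = non-vanishing of the linear forms
(on the clean shell it follows from `|A| = |ϖ^{ℓ₀}|`, ★ `v_A_eq_of_one_le`; supplied by the assembler). [cite: Kottwitz1986BaseChangeUnits, §1 pp. 240–241]
[cite: LanglandsShelstad1987, §3] [cite: Rogawski1990, §4.9 Prop. 4.9.1 (a)(b) p. 55] -/
theorem labelledOddCount_div_relIndex_coreHanging_rep_eq (hD : IsRamifiedQuadraticDatum σ ϖ d t) (h2 : Valued.v (2 : K) < 1)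
    {ρ : ℕ} (hρ : 1 ≤ ρ) {g : K} (hσg : σ g = g) (hg : Valued.v g = 1) (h1g : Valued.v (1 + g) = 1)
    (V : GL (Fin 3) K) (hV : (V : Matrix (Fin 3) (Fin 3) K) = !![1, 0, 0; 1, ϖ ^ ρ, 0; 1 * 1 + g, ϖ ^ ρ * 1, ϖ ^ (2 * ρ)])
    (hE : IsElementDatum σ ϖ N₀ α β n₁ n₂ n₃) {mc : ℕ} (hℓN : d % 2 + 1 ≤ N₀) (hmN : d % 2 + 2 * d - 1 ≤ N₀)
    (hℓmc : 2 * (d % 2) + 1 ≤ mc) (hmmc : d % 2 + 2 * d - 1 + d % 2 ≤ mc)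
    (hlev : LatticeInLevel ϖ (d % 2) (Matrix.diagonal ![α - 1, β - 1, 0]) (latt (V : Matrix (Fin 3) (Fin 3) K)))
    (hnlev : ¬ LatticeInLevel ϖ (d % 2 + 1) (Matrix.diagonal ![α - 1, β - 1, 0]) (latt (V : Matrix (Fin 3) (Fin 3) K)))
    (hsq : LatticeInLevel ϖ mc (Matrix.diagonal ![(α - 1) * (α - 1), (β - 1) * (β - 1), 0]) (latt (V : Matrix (Fin 3) (Fin 3) K)))
    {T : GL (Fin 3) K} (hT : (T : Matrix (Fin 3) (Fin 3) K) = Matrix.diagonal ![α, β, 1])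
    (hTM : mapGL T (latt (V : Matrix (Fin 3) (Fin 3) K)) = latt (V : Matrix (Fin 3) (Fin 3) K))
    {gα gβ : K} (hσgα : σ gα = gα) (hσgβ : σ gβ = gβ)
    (hgα : Valued.v ((ϖ ^ (d % 2 + 2 * d - 1))⁻¹ * (((ϖ * σ ϖ) ^ ρ)⁻¹ * ((α - 1) - gα * ((ϖ - σ ϖ) * ((ϖ * σ ϖ) ^ ((d - d % 2) / 2))⁻¹)))) ≤ 1)
    (hgβ : Valued.v ((ϖ ^ (d % 2 + 2 * d - 1))⁻¹ * (((ϖ * σ ϖ) ^ ρ)⁻¹ * ((β - 1) - gβ * ((ϖ - σ ϖ) * ((ϖ * σ ϖ) ^ ((d - d % 2) / 2))⁻¹)))) ≤ 1)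
    (Aβ Aγ : Finset K)
    (hAγsub : ∀ a ∈ Aγ, σ a = a ∧ Valued.v (a - 1) ≤ Valued.v ϖ ^ (2 * ρ))
    (hAγ : ∀ p : K, σ p = p → Valued.v (p - 1) ≤ Valued.v ϖ ^ (2 * ρ) →
      ∃! a, a ∈ Aγ ∧ ∃ w : K, Valued.v (w - 1) ≤ Valued.v ϖ ^ (2 * ρ) ∧ w * σ w = a / p)
    (hAβsub : ∀ a ∈ Aβ, σ a = a ∧ Valued.v (a - 1) ≤ Valued.v ϖ ^ ρ)
    (hAβ : ∀ y : K, σ y = y → Valued.v (y - 1) ≤ Valued.v ϖ ^ ρ →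
      ∃! a, a ∈ Aβ ∧ ∃ s : K, Valued.v (s - 1) ≤ Valued.v ϖ ^ (2 * ρ) ∧ s * σ s = a / y)
    (hL : ∀ aβ ∈ Aβ, ∀ aγ ∈ Aγ, g * gα + aγ * (aβ + g⁻¹ * (aβ - 1))⁻¹ * gβ ≠ 0)
    (i : Fin 3) :
    (labelledOddCount σ ϖ 0 i (valueClassLabel σ ϖ (α - 1) (β - 1) (d % 2 + 2 * d - 1) d) (latt (V : Matrix (Fin 3) (Fin 3) K)) : ℚ) /
        ((((unitStabilizer (latt (V : Matrix (Fin 3) (Fin 3) K))).map (unitNormMap σ 3)).relIndex (fixedUnitTorus σ 3) : ℕ) : ℚ) =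
      (normSign σ ((![((ϖ * σ ϖ) ^ ρ)⁻¹ * g, ((ϖ * σ ϖ) ^ ρ)⁻¹, -(((ϖ * σ ϖ) ^ ρ)⁻¹ * (1 + g)⁻¹)] : Fin 3 → K) i) : ℚ) *
        stabiliserWeight σ (latt (V : Matrix (Fin 3) (Fin 3) K)) / (2 * (Aβ.card : ℚ) * (Aγ.card : ℚ)) *
        ((∑ aβ ∈ Aβ, ∑ aγ ∈ Aγ,
          normSign σ ((![(1 : K), aγ * (aβ + g⁻¹ * (aβ - 1))⁻¹, aγ * (aβ + g⁻¹ * (aβ - 1))⁻¹ * aβ] : Fin 3 → K) i) *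
            normSign σ (g * gα + aγ * (aβ + g⁻¹ * (aβ - 1))⁻¹ * gβ) : ℤ) : ℚ) := by
  classical
  have hD' := hD
  obtain ⟨hσ, hvσ, hϖ, -, -, -, -⟩ := hD'
  haveI := Literature.NumberTheory.LocalFields.isAdicComplete_valuedInteger_of_completeSpace hϖ
  have hϖ0 : ϖ ≠ 0 := fun h0 => by rw [h0, map_zero] at hϖ; exact WithZero.coe_ne_zero hϖ.symm
  have hϖ1 : Valued.v ϖ < 1 := by rw [hϖ, ← WithZero.exp_zero, WithZero.exp_lt_exp]; norm_num
  obtain ⟨c, hσc, hcv, hc, hdich⟩ := exists_nonnorm_dichotomy_of_isRamifiedQuadraticDatum σ ϖ d t hD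
  have hc0 : c ≠ 0 := fun h => by rw [h, map_zero] at hcv; exact zero_ne_one hcv
  have h1c : (1 : K) ≠ c := fun h => hc ⟨1, by rw [map_one, one_mul, h]⟩
  -- `|z| = 1` when `z·σz` is a unit
  have hunit : ∀ {z w : K}, z * σ z = w → Valued.v w = 1 → Valued.v z = 1 := by
    intro z w hz hw
    have h2 : Valued.v z * Valued.v z = 1 := by
      have := congrArg Valued.v hz
      rwa [map_mul, hvσ, hw] at this
    have h2' : Valued.v z ^ 2 = 1 := by rw [sq]; exact h2
    exact (pow_eq_one_iff.1 h2').resolve_right (by norm_num)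
  -- `A₀ = {1, c}` is an ∃!-system of the fixed units modulo unit norms
  have hA₀sub : ∀ a ∈ ({1, c} : Finset K), σ a = a ∧ Valued.v a = 1 := fun a ha => by
    rcases Finset.mem_insert.1 ha with rfl | h
    · exact ⟨map_one σ, map_one _⟩
    · rw [Finset.mem_singleton.1 h]; exact ⟨hσc, hcv⟩
  have h1mem : (1 : K) ∈ ({1, c} : Finset K) := Finset.mem_insert_self _ _
  have hcmem : c ∈ ({1, c} : Finset K) := Finset.mem_insert_of_mem (Finset.mem_singleton_self _)
  have hA₀ : ∀ x : K, σ x = x → Valued.v x = 1 → ∃! a, a ∈ ({1, c} : Finset K) ∧ ∃ e : K, Valued.v e = 1 ∧ e * σ e = a / x := by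
    intro x hσx hvx
    have hx0 : x ≠ 0 := fun h => by rw [h, map_zero] at hvx; exact zero_ne_one hvx
    -- no element can be represented by both `1` and `c`
    have hexcl : ∀ e e' : K, e * σ e = 1 / x → e' * σ e' = c / x → False := by
      intro e e' he he'
      have he0 : e ≠ 0 := fun h => by
        rw [h, zero_mul] at he; exact div_ne_zero one_ne_zero hx0 he.symm
      apply hc
      refine ⟨e' / e, ?_⟩
      rw [map_div₀, div_mul_div_comm, he, he']
      field_simp
    rcases hdich x hσx hx0 with ⟨z, hz⟩ | ⟨z, hz⟩
    · have hz1 : Valued.v z = 1 := hunit hz hvx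
      have hz0 : z ≠ 0 := fun h => by rw [h, map_zero] at hz1; exact zero_ne_one hz1
      refine ⟨1, ⟨h1mem, z⁻¹, by rw [map_inv₀, hz1, inv_one], by rw [map_inv₀, ← mul_inv, hz, one_div]⟩, ?_⟩
      rintro a ⟨ha, e, -, he⟩
      rcases Finset.mem_insert.1 ha with rfl | h
      · rfl
      · rw [Finset.mem_singleton.1 h] at he
        exact (hexcl z⁻¹ e (by rw [map_inv₀, ← mul_inv, hz, one_div]) he).elim
    · have hcx : Valued.v (c * x) = 1 := by rw [map_mul, hcv, hvx, one_mul]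
      have hz1 : Valued.v z = 1 := hunit hz hcx
      refine ⟨c, ⟨hcmem, z / x, by rw [map_div₀, hz1, hvx, div_one], ?_⟩, ?_⟩
      · rw [map_div₀, hσx, div_mul_div_comm, hz]
        field_simp
      · rintro a ⟨ha, e, -, he⟩
        rcases Finset.mem_insert.1 ha with rfl | h
        · exact (hexcl e (z / x) he (by rw [map_div₀, hσx, div_mul_div_comm, hz]; field_simp)).elim
        · exact (Finset.mem_singleton.1 h).symm ▸ rfl
  -- polarisation data of the representative (★ κG-A1) and `N′ ≤ S_F`
  have hg0 : g ≠ 0 := fun h => by rw [h, map_zero] at hg; exact zero_ne_one hg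
  have h1g0 : 1 + g ≠ 0 := fun h => by rw [h, map_zero] at h1g; exact zero_ne_one h1g
  -- the `t = 0` letters of the ★ glued kit
  have hg' : Valued.v g = Valued.v ϖ ^ (2 * 0) := by rw [mul_zero, pow_zero]; exact hg
  have hV' : (V : Matrix (Fin 3) (Fin 3) K) = !![1, 0, 0; 1, ϖ ^ ρ, 0; 1 * 1 + g, ϖ ^ ρ * 1, ϖ ^ (2 * ρ + 2 * 0)] := by rw [mul_zero, add_zero]; exact hV
  have hAβsub' : ∀ a ∈ Aβ, σ a = a ∧ Valued.v (a - 1) ≤ Valued.v ϖ ^ (ρ + 2 * 0) := by simpa using hAβsub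
  have hAβ' : ∀ y : K, σ y = y → Valued.v (y - 1) ≤ Valued.v ϖ ^ (ρ + 2 * 0) →
      ∃! a, a ∈ Aβ ∧ ∃ s : K, Valued.v (s - 1) ≤ Valued.v ϖ ^ (2 * ρ + 2 * 0) ∧ s * σ s = a / y := by simpa using hAβ
  have hn : IsNormalisedLattice (latt (V : Matrix (Fin 3) (Fin 3) K)) := by
    rw [hV]; exact isNormalisedLattice_latt_coreHanging hϖ1.le ρ (x := 1) (ζ := 1) (map_one _) (map_one _) (by rw [one_mul]; exact h1g)
  have hV₁ := isVertexLattice_zero_latt_coreHanging_rep hD h2 ρ hρ hσg hg h1g V hV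
  have hD₁ := coreHanging_rep_polarisation_fixed_ne_zero hσ hϖ0 ρ hσg hg0 h1g0
  have hcoset := fun D hD => fibre_isCoset_zero hvσ ϖ V rfl hn _ hD₁ hV₁ D hD
  have hN'S : (unitStabilizer (latt (V : Matrix (Fin 3) (Fin 3) K))).map (unitNormMap σ 3) ≤ fixedUnitStabilizer σ (latt (V : Matrix (Fin 3) (Fin 3) K)) :=
    map_unitNormMap_unitStabilizer_le σ hσ ϖ 0 hD₁ hV₁ hcoset
  have hSU : fixedUnitStabilizer σ (latt (V : Matrix (Fin 3) (Fin 3) K)) ≤ fixedUnitTorus σ 3 :=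
    fun u hu => (mem_fixedUnitTorus_iff σ u).2 ((mem_fixedUnitStabilizer_iff σ _ u).1 hu).2
  have hfinOrb : {M : Submodule 𝒪[K] (Fin 3 → K) | ∃ u ∈ unitTorus K 3, M = mapGL (diagGLUnits u) (latt (V : Matrix (Fin 3) (Fin 3) K))}.Finite :=
    finite_unitTorus_orbit_of_mem_normalisedStableLattices hϖ (v_diag_eq_one hvσ hE) (diag_regular hE) T hT ⟨⟨V, rfl⟩, hTM, hn⟩
  have hUN := relIndex_map_unitNormMap_unitStabilizer_ne_zero hσ hvσ hσc hcv hc hdich hfinOrb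
  have hSF0 := relIndex_fixedUnitStabilizer_ne_zero_of_finite σ hfinOrb
  -- a transversal of `S_F ∕ N′`
  have htower : ((unitStabilizer (latt (V : Matrix (Fin 3) (Fin 3) K))).map (unitNormMap σ 3)).relIndex (fixedUnitStabilizer σ (latt (V : Matrix (Fin 3) (Fin 3) K))) *
      (fixedUnitStabilizer σ (latt (V : Matrix (Fin 3) (Fin 3) K))).relIndex (fixedUnitTorus σ 3) =
      ((unitStabilizer (latt (V : Matrix (Fin 3) (Fin 3) K))).map (unitNormMap σ 3)).relIndex (fixedUnitTorus σ 3) :=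
    Subgroup.relIndex_mul_relIndex _ _ _ hN'S hSU
  have hidx : ((unitStabilizer (latt (V : Matrix (Fin 3) (Fin 3) K))).map (unitNormMap σ 3)).relIndex (fixedUnitStabilizer σ (latt (V : Matrix (Fin 3) (Fin 3) K))) ≠ 0 :=
    fun h => hUN (by rw [← htower, h, zero_mul])
  obtain ⟨R, hRS, hR⟩ := exists_transversal_of_relIndex_ne_zero hidx
  -- the product subgroup, the product transversal, LEMMA A (LH7-p08's ★ FILE 2b) and LEMMA B
  obtain ⟨Dρ, hDρ⟩ := exists_deepRatioSubgroup (K := K) ϖ ρ 0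
  have hN₀N' := map_deepRatioSubgroup_le_map_unitStabilizer_glued_rep σ hϖ0 hϖ1.le ρ 0 hg' V hV' hDρ
  obtain ⟨R₀, hR₀, hR₀card⟩ := exists_productTransversal hϖ0 hϖ1 hρ hg' ({1, c} : Finset K) Aβ Aγ (fun a ha => (hA₀sub a ha).2)
    (fun a ha => (hAγsub a ha).2) (fun a ha => (hAβsub' a ha).2)
  obtain ⟨hR₀S, hR₀T⟩ := productTransversal_glued_rep hvσ hϖ0 hϖ1 hρ hσg hg' V hV' hDρ ({1, c} : Finset K) Aβ Aγ hA₀sub hA₀ hAγsub hAγ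
    hAβsub' hAβ' R₀ hR₀
  have hA := two_mul_card_mul_labelledOddCount_coreHanging_rep_eq hD hρ hσg hg0 h1g V hV hV₁ hE hℓN hmN hℓmc hmmc hlev hnlev hsq hT hTM hσgα hσgβ
    hgα hgβ i R hRS hR hN₀N' R₀ hR₀S hR₀T
  have hB := sum_productTransversal_classSign_eq hD hρ hσg hg' hσgα hσgβ hσc hcv hc Aβ Aγ hAγsub hAβsub' hL R₀ hR₀ i
  rw [hB] at hA
  -- cardinalities: `#(R₀ ∩ N′)·[𝒰 : N′] = #R₀·[𝒰 : S_F]`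
  have hc1 : (R₀.filter fun r => r ∈ (unitStabilizer (latt (V : Matrix (Fin 3) (Fin 3) K))).map (unitNormMap σ 3)).card =
      (Dρ.map (unitNormMap σ 3)).relIndex ((unitStabilizer (latt (V : Matrix (Fin 3) (Fin 3) K))).map (unitNormMap σ 3)) := by
    refine card_eq_relIndex_of_transversal _ (fun r hr => (Finset.mem_filter.1 hr).2) (fun u hu => ?_)
    obtain ⟨r, ⟨hr, hur⟩, huniq⟩ := hR₀T u (hN'S hu)
    refine ⟨r, ⟨Finset.mem_filter.2 ⟨hr, ?_⟩, hur⟩, fun r' hr' => huniq r' ⟨(Finset.mem_filter.1 hr'.1).1, hr'.2⟩⟩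
    have e : r = u * (u⁻¹ * r) := by rw [mul_inv_cancel_left]
    rw [e]
    exact mul_mem hu (hN₀N' hur)
  have hc2 : R₀.card = (Dρ.map (unitNormMap σ 3)).relIndex (fixedUnitStabilizer σ (latt (V : Matrix (Fin 3) (Fin 3) K))) :=
    card_eq_relIndex_of_transversal R₀ hR₀S hR₀T
  have ht1 := Subgroup.relIndex_mul_relIndex _ _ _ hN₀N' (hN'S.trans hSU)
  have ht2 := Subgroup.relIndex_mul_relIndex _ _ _ (hN₀N'.trans hN'S) hSU
  have hkey : (R₀.filter fun r => r ∈ (unitStabilizer (latt (V : Matrix (Fin 3) (Fin 3) K))).map (unitNormMap σ 3)).card *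
      ((unitStabilizer (latt (V : Matrix (Fin 3) (Fin 3) K))).map (unitNormMap σ 3)).relIndex (fixedUnitTorus σ 3) =
      R₀.card * (fixedUnitStabilizer σ (latt (V : Matrix (Fin 3) (Fin 3) K))).relIndex (fixedUnitTorus σ 3) := by
    rw [hc1, hc2, ht1, ht2]
  have h2card : ({1, c} : Finset K).card = 2 := Finset.card_pair h1c
  rw [h2card] at hR₀card
  have hAβne : Aβ.card ≠ 0 := by
    obtain ⟨a, ⟨ha, -⟩, -⟩ := hAβ 1 (map_one σ) (by rw [sub_self, map_zero]; exact zero_le)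
    exact Finset.card_ne_zero_of_mem ha
  have hAγne : Aγ.card ≠ 0 := by
    obtain ⟨a, ⟨ha, -⟩, -⟩ := hAγ 1 (map_one σ) (by rw [sub_self, map_zero]; exact zero_le)
    exact Finset.card_ne_zero_of_mem ha
  -- to `ℚ`
  have hAq : (2 : ℚ) * ((R₀.filter fun r => r ∈ (unitStabilizer (latt (V : Matrix (Fin 3) (Fin 3) K))).map (unitNormMap σ 3)).card : ℚ) *
      (labelledOddCount σ ϖ 0 i (valueClassLabel σ ϖ (α - 1) (β - 1) (d % 2 + 2 * d - 1) d) (latt (V : Matrix (Fin 3) (Fin 3) K)) : ℚ) =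
      (normSign σ ((![((ϖ * σ ϖ) ^ ρ)⁻¹ * g, ((ϖ * σ ϖ) ^ ρ)⁻¹, -(((ϖ * σ ϖ) ^ ρ)⁻¹ * (1 + g)⁻¹)] : Fin 3 → K) i) : ℚ) *
        (2 * ((∑ aβ ∈ Aβ, ∑ aγ ∈ Aγ,
          normSign σ ((![(1 : K), aγ * (aβ + g⁻¹ * (aβ - 1))⁻¹, aγ * (aβ + g⁻¹ * (aβ - 1))⁻¹ * aβ] : Fin 3 → K) i) *
            normSign σ (g * gα + aγ * (aβ + g⁻¹ * (aβ - 1))⁻¹ * gβ) : ℤ) : ℚ)) := by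
    exact_mod_cast hA
  have hkeyq : ((R₀.filter fun r => r ∈ (unitStabilizer (latt (V : Matrix (Fin 3) (Fin 3) K))).map (unitNormMap σ 3)).card : ℚ) *
      ((((unitStabilizer (latt (V : Matrix (Fin 3) (Fin 3) K))).map (unitNormMap σ 3)).relIndex (fixedUnitTorus σ 3) : ℕ) : ℚ) =
      (2 * (Aβ.card : ℚ) * (Aγ.card : ℚ)) * (((fixedUnitStabilizer σ (latt (V : Matrix (Fin 3) (Fin 3) K))).relIndex (fixedUnitTorus σ 3) : ℕ) : ℚ) := by
    have := hkey
    rw [hR₀card] at this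
    exact_mod_cast this
  have hUNq : ((((unitStabilizer (latt (V : Matrix (Fin 3) (Fin 3) K))).map (unitNormMap σ 3)).relIndex (fixedUnitTorus σ 3) : ℕ) : ℚ) ≠ 0 :=
    Nat.cast_ne_zero.2 hUN
  have hSFq : (((fixedUnitStabilizer σ (latt (V : Matrix (Fin 3) (Fin 3) K))).relIndex (fixedUnitTorus σ 3) : ℕ) : ℚ) ≠ 0 :=
    Nat.cast_ne_zero.2 hSF0
  have hAβq : (Aβ.card : ℚ) ≠ 0 := Nat.cast_ne_zero.2 hAβne
  have hAγq : (Aγ.card : ℚ) ≠ 0 := Nat.cast_ne_zero.2 hAγne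
  have hkq : ((R₀.filter fun r => r ∈ (unitStabilizer (latt (V : Matrix (Fin 3) (Fin 3) K))).map (unitNormMap σ 3)).card : ℚ) ≠ 0 := by
    intro h0
    rw [h0, zero_mul] at hkeyq
    exact (mul_ne_zero (mul_ne_zero (mul_ne_zero two_ne_zero hAβq) hAγq) hSFq) hkeyq.symm
  rw [stabiliserWeight]
  generalize (labelledOddCount σ ϖ 0 i (valueClassLabel σ ϖ (α - 1) (β - 1) (d % 2 + 2 * d - 1) d) (latt (V : Matrix (Fin 3) (Fin 3) K)) : ℚ) = Lq at hAq ⊢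
  generalize (normSign σ ((![((ϖ * σ ϖ) ^ ρ)⁻¹ * g, ((ϖ * σ ϖ) ^ ρ)⁻¹, -(((ϖ * σ ϖ) ^ ρ)⁻¹ * (1 + g)⁻¹)] : Fin 3 → K) i) : ℚ) = ωq at hAq ⊢
  generalize ((∑ aβ ∈ Aβ, ∑ aγ ∈ Aγ,
          normSign σ ((![(1 : K), aγ * (aβ + g⁻¹ * (aβ - 1))⁻¹, aγ * (aβ + g⁻¹ * (aβ - 1))⁻¹ * aβ] : Fin 3 → K) i) *
            normSign σ (g * gα + aγ * (aβ + g⁻¹ * (aβ - 1))⁻¹ * gβ) : ℤ) : ℚ) = Sq at hAq ⊢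
  generalize ((R₀.filter fun r => r ∈ (unitStabilizer (latt (V : Matrix (Fin 3) (Fin 3) K))).map (unitNormMap σ 3)).card : ℚ) = kq at hAq hkeyq hkq
  generalize ((((unitStabilizer (latt (V : Matrix (Fin 3) (Fin 3) K))).map (unitNormMap σ 3)).relIndex (fixedUnitTorus σ 3) : ℕ) : ℚ) = NU at hkeyq hUNq ⊢
  generalize (((fixedUnitStabilizer σ (latt (V : Matrix (Fin 3) (Fin 3) K))).relIndex (fixedUnitTorus σ 3) : ℕ) : ℚ) = SFU at hkeyq hSFq ⊢
  generalize (Aβ.card : ℚ) = nβ at hkeyq hAβq ⊢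
  generalize (Aγ.card : ℚ) = nγ at hkeyq hAγq ⊢
  rw [div_eq_iff hUNq]
  field_simp
  linear_combination (NU / 2) * hAq - Lq * hkeyq


end Summit.HodgeConjecture.HodgeConjecture.Cruxes.H413.F0P3cDyRamLabelledOddCoreHangingRepClassSum

end
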